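import Summits.BirchSwinnertonDyer.BirchSwinnertonDyer.Theses.ByReductionTypeAtTwo
import Summits.BirchSwinnertonDyer.BirchSwinnertonDyer.Theses.TwoAdicConverse
import Summits.BirchSwinnertonDyer.BirchSwinnertonDyer.Theorems.ByReductionTypeAtTwoOrdMissingLowerBoundAtTwoOfChildren
import Literature.NumberTheory.EllipticCurves.IsogenyHomProofs

/-! # crux-triage r1 seat 1, GEN 22 probe — the PRINT BUNDLE stmt-23764 read for junk instances (K4 rev 36 → 37, 2026-08-29T01:2xZ; rev 37 = P6, new top-level slot 7 stmt-23932 on the RANK-ONE branch — the crux-203 block ll. 656–720 is text-identical, sha16 1f22a59f0733880c)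

(B22) Crux 203 `OrdMissingLowerBoundAtTwo` (stmt-19577) is open on exactly two K4 items: the support child
stmt-23764 `OrdMLBPrintBundleAtTwo` (PRINT by name) and the crux child stmt-19556 (glue stmt-23765 CLOSED, p676269).
A print bundle that were FALSE AS TYPED for a junk reason (an unpinned interface under a `∀`, an unguarded
auxiliary binder) would make the cone unsound for the wrong reason.  This file records, from TREE decls only:
* `bundle_iff` / `pub_iff` — the bundle is definitionally (modularity ∧ GZK ∧ Kato 17.4(1)(2)@2 ∧ Greenberg 4.1@any p)
  ∧ Cassels ∧ Abbes–Ullmo ∧ Stevens/CES T2;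
* `kato_conjunct_guarded` — the Kato conjunct's auxiliary binder `f : CuspForm Γ₀(N_W) 2` is GUARDED by
  `IsNewformOf W f` inside `kato_divisibility_allPrimes` (so `f = 0` / a foreign eigenform is not a junk instance);
* `cassels_iff`, `isIsogenous_iff`, `Isogeny.toAddMonoidHom_ne_zero` — the Cassels conjunct quantifies over
  `IsIsogenous W W' := Nonempty (Isogeny W W')`, and an `Isogeny` is a Γ_ℚ-equivariant ALGEBRAIC homomorphism on
  geometric points with FINITE kernel; in particular the zero homomorphism is never an isogeny between elliptic
  curves (kernel = E(ℚ̄) is infinite), so «every pair is isogenous» junk is excluded and both curves are globally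
  minimal with `W.ShaFinite` as an explicit hypothesis;
* `glue_landed`, `crux203_of_items` — unchanged re-certification on rev 37 (19577 from 19149, 19567, 20090, 23771, 19556 BY NAME).
`isAlgebraic : IsAlgebraicOn` (Literature `…/Isogeny.lean` :101–121) demands `Q₁(x,y) ≠ 0 ∧ Q₂(x,y) ≠ 0` and agreement with the
rational map at all but finitely many points, so neither vanishing-denominator junk nor an abstract (non-algebraic)
equivariant homomorphism inhabits `Isogeny`.
Kernel facts only; nothing asserted about BSD; stmt-19577 / stmt-19556 NOT proved; not a landing. -/

set_option linter.dupNamespace false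

namespace Summit.BirchSwinnertonDyer.BirchSwinnertonDyer.Cruxes.OrdMissingLowerBoundAtTwo.TriageR1Seat1.BundlePinnedGen22

open Summit.BirchSwinnertonDyer.BirchSwinnertonDyer
open Summit.BirchSwinnertonDyer.BirchSwinnertonDyer.Theses.ByReductionTypeAtTwo
open Literature.NumberTheory.EllipticCurves Literature.NumberTheory.EllipticCurves.ModularForms

/-- stmt-23764 = 19149 ∧ Cassels ∧ AU ∧ T2, definitionally (rev 36/37). -/
theorem bundle_iff : OrdMLBPrintBundleAtTwo ↔
    (Literature.Uncategorized.OrdPublishedInputsAtTwo ∧ WeierstrassCurve.bsdRHS_eq_of_isIsogenous ∧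
      abbesUllmo_not_dvd_maninConstant_of_not_dvd_level ∧ exists_optimal_gamma1ParametrizationData) := Iff.rfl

/-- item 19149 (PUB) = modularity ∧ GZK ∧ Kato 17.4 (1)(2) at 2 (for every W and every GUARDED f) ∧ Greenberg Thm 4.1 at every p. -/
theorem pub_iff : OrdPublishedInputsAtTwo ↔
    (nonempty_modularParametrizationData ∧ rank_eq_analyticRank_of_analyticRank_le_one ∧
      (∀ (W : WeierstrassCurve ℚ) [W.IsElliptic] [W.IsGloballyMinimal] [NeZero (W.conductorNorm ℤ)]
        (f : CuspForm (CongruenceSubgroup.Gamma0 (W.conductorNorm ℤ)) 2),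
        kato_divisibility_allPrimes W 2 (f := f)) ∧
      Greenberg1999.thm41_charValue_rankZero_anyPrime) := Iff.rfl

/-- The Kato conjunct's `f` is guarded: `kato_divisibility_allPrimes W 2 (f := f)` only speaks about `f` under
`IsNewformOf W f` (verbatim unfolding). -/
theorem kato_conjunct_guarded (W : WeierstrassCurve ℚ) [W.IsElliptic] [W.IsGloballyMinimal]
    [NeZero (W.conductorNorm ℤ)] (f : CuspForm (CongruenceSubgroup.Gamma0 (W.conductorNorm ℤ)) 2) :
    kato_divisibility_allPrimes W 2 (f := f) ↔
      ∀ (κ : ZpExtension ℚ 2) (γ : Field.absoluteGaloisGroup ℚ), κ.IsCyclotomic →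
        κ.IsTopGenerator γ → IsCyclotomicVariable 2 γ → IsOrdinaryAt W 2 → IsNewformOf W f →
        ∀ D : W.SelmerDualData κ γ, D.IsTorsion ∧
          ∃ (n : ℕ) (g : IwasawaAlgebra 2), g ∈ D.charIdeal ∧
            iwasawaToPowerSeries 2 g =
              PowerSeries.C ((2 : ℚ_[2]) ^ n) * padicLFunction f (unitRoot W 2 : ℚ_[2]) := by
  simp only [kato_divisibility_allPrimes, Nat.cast_ofNat]

/-- The Cassels conjunct, verbatim: both curves globally minimal, `W.ShaFinite` an explicit hypothesis. -/
theorem cassels_iff : WeierstrassCurve.bsdRHS_eq_of_isIsogenous ↔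
    ∀ (W W' : WeierstrassCurve ℚ) [W.IsElliptic] [W'.IsElliptic] [W.IsGloballyMinimal] [W'.IsGloballyMinimal],
      WeierstrassCurve.IsIsogenous W W' → W.ShaFinite → W'.ShaFinite ∧ W'.bsdRHS = W.bsdRHS := Iff.rfl

/-- `IsIsogenous` is inhabitation of the PINNED structure `Isogeny`. -/
theorem isIsogenous_iff (W W' : WeierstrassCurve ℚ) :
    WeierstrassCurve.IsIsogenous W W' ↔ Nonempty (WeierstrassCurve.Isogeny W W') := Iff.rfl

/-- No zero-map junk: an `Isogeny` out of an ELLIPTIC curve is never the zero homomorphism (its kernel is finite,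
`E(ℚ̄)` is infinite — `WeierstrassCurve.geomPoints.instInfinite`). -/
theorem Isogeny.toAddMonoidHom_ne_zero {W W' : WeierstrassCurve ℚ} [W.IsElliptic]
    (φ : WeierstrassCurve.Isogeny W W') : φ.toAddMonoidHom ≠ 0 := by
  intro h
  have hker : (φ.toAddMonoidHom.ker : Set W.geomPoints) = Set.univ := by
    ext P
    simp [h]
  have hfin := φ.finite_ker
  rw [hker] at hfin
  exact Set.infinite_univ hfin

/-- … so «every pair of curves is isogenous via 0» is not available: distinct-isogeny-class junk cannot
inhabit the Cassels conjunct's hypothesis. (Pointwise form.) -/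
theorem Isogeny.exists_apply_ne_zero {W W' : WeierstrassCurve ℚ} [W.IsElliptic]
    (φ : WeierstrassCurve.Isogeny W W') : ∃ P : W.geomPoints, φ.toAddMonoidHom P ≠ 0 := by
  by_contra h
  exact Isogeny.toAddMonoidHom_ne_zero φ
    (AddMonoidHom.ext fun P => by simpa using not_not.mp (not_exists.mp h P))

/-- child dedup, unchanged at rev 36/37: the K4 crux child is S3's stmt-19556 verbatim. -/
theorem child_iff_S3 :
    Theses.ByReductionTypeAtTwo.OrdLambdaHalfAtTwo ↔ Theses.TwoAdicConverse.OrdLambdaHalfAtTwo := Iff.rfl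

/-- the glue item stmt-23765 is closed in the TREE: the landed theorem p676269, by name. -/
theorem glue_landed : OrdMissingLowerBoundAtTwoOfChildren :=
  Theorems.KatoFreeSandwich.ordMissingLowerBoundAtTwoOfChildren_proof

/-- crux 203 (stmt-19577) on rev 37 from K4's own items 19149, 19567, 20090, 23771 and S3's 19556, all BY NAME
(conditional restatement; closes nothing). -/
theorem crux203_of_items (hPub : OrdPublishedInputsAtTwo) (hIso : OrdIsoPublishedInputsAtTwo)
    (hAU : AsideAbbesUllmoManinAtTwo) (hT2 : AsideStevensOptimalGamma1AtTwo)
    (hLam : Theses.TwoAdicConverse.OrdLambdaHalfAtTwo) : OrdMissingLowerBoundAtTwo :=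
  glue_landed ⟨hPub, hIso.1, hAU, hT2⟩ (child_iff_S3.mpr hLam)

end Summit.BirchSwinnertonDyer.BirchSwinnertonDyer.Cruxes.OrdMissingLowerBoundAtTwo.TriageR1Seat1.BundlePinnedGen22
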